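import Mathlib
import HarnessLib
import Summits.Ventures.LatticeQCDFlow.Exactness.NCMCGeneralSpaceGammaMethodIntervalForm
import Summits.Ventures.LatticeQCDFlow.Exactness.NCMCGeneralSpaceIndicatorCLT
import Summits.Ventures.LatticeQCDFlow.Exactness.NCMCGeneralSpaceRestartChainEveryStart
import Summits.Ventures.LatticeQCDFlow.Exactness.NCMCGeneralSpaceTwoSampleCLT

/-!
# The Jarzynski lane along CORRELATED starts: the printed `dF ± z · (Γ-method error of the mean weight)/(mean weight)` has asymptotically exact coverage from EVERY initial record law

HONEST FRAMING: exact (Metropolis-corrected) sampling algorithms for lattice gauge theory;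
figures of merit are autocorrelation/cost numbers at stated couplings and volumes; no
continuum-physics claim.

Venture `LatticeQCDFlow` (cell pub-lqcd), topic `Exactness`; FANOUT row 13 (`eng-snf`, GEN-22).
NEW WORK of the cell, not a published result; no definition is introduced; nothing is cited as a
fact.  Companion of `NCMCGeneralSpaceRestartChainCLT.lean` (the CLT of `ΔF̂_n` along the restart
chain `R = (κF ∘ₖ K).comap s` for bounded-below work).  `latflow-snf` prints, next to
`dF = −log Ȳ_n` (`Ȳ_n` the mean Jarzynski weight of `n` launches off ONE equilibrium stream),
the error `err = z · √(Γ̂_n(0) · 2 τ̂_{n,W} / n) / Ȳ_n` — the Γ-method (windowed-autocovariance)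
error of the MEAN WEIGHT, propagated through `−log` (relative error of `Ȳ_n` = absolute error of
`dF`).  GEN-20 proved that scorer A's Γ-method statistic `Γ̂_N(0) · 2 τ̂_{N,W_N}` is consistent for
the Green–Kubo variance under a Doeblin power from every initial law and that the studentized chain
CLT holds (`NCMCGeneralSpaceGammaMethodStudentizedCLT`, `…IntervalForm`); the restart kernel is
minorised in ONE step (`CrooksPair.restartKernel_nHit_one_minorised`, GEN-18), so those theorems
apply to the weight series `e^{−W(ω_0)}, e^{−W(ω_1)}, …`; the exact identity
`ΔF̂_n − ΔF = −(Ȳ_n − θ) · dslope log θ Ȳ_n` (`θ = Z₁/Z₀ = e^{−ΔF}`), the every-start strong law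
`Ȳ_n → θ` (`CrooksPair.tendsto_sampleMean_restartChain_anyLaw`) and GEN-20's plug-in coverage lemma
with a scale converging in probability (`tendsto_measure_abs_mul_le_of_clt_of_tendstoInMeasure`)
finish.

## Content (Crooks pair between finite weights, `Z₀ ≠ 0`, `e^{−ΔF} = Z₁/Z₀`; bounded-below work
## `−B ≤ W`; `K` Markov, `ν₀`-invariant, `m ≤ K(z, ·)` ∀ `z`, `m` finite non-zero; `σ²_w > 0` the
## Green–Kubo variance of the weights along `R`; windows `W_n → ∞`, `W_n³/n → 0`; `z > 0`;
## `Γ̂_n`, `ρ̂_n`, `τ̂_{n,W}` = scorer A's `Scoring.gammaHat`, `rhoHat`, `tauIntWindow` of the weights)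

* `abs_studentizedLog_le_iff` — `n ≥ 1`, `v > 0`, `Y > 0`:
  `|√n D · Y · (√v)⁻¹| ≤ z ↔ |D| ≤ z √(v/n) / Y` (the studentized event IS the printed interval).
* **`CrooksPair.tendsto_measure_studentized_jarzynskiEstimate_le_restartChain`** — from EVERY
  initial record law `μ₀`:
  `P_{μ₀}{ |√n (ΔF̂_n − ΔF) · Ȳ_n · (√(Γ̂_n(0) · 2 τ̂_{n,W_n}))⁻¹| ≤ z } → gaussianReal 0 1 (Icc (−z) z)`.
* **`CrooksPair.tendsto_measure_jarzynskiEstimate_mem_gammaInterval_restartChain`** — THE PRINTED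
  INTERVAL: `P_{μ₀}{ |ΔF̂_n − ΔF| ≤ z √(Γ̂_n(0) · 2 τ̂_{n,W_n} / n) / Ȳ_n } → gaussianReal 0 1 (Icc (−z) z)`
  (the two events differ only on `{Γ̂_n(0) · 2 τ̂ ≤ 0} ∪ {n = 0}`, of vanishing probability), and
  **`…_everyStart`** — the engine's form, first record launched from ANY configuration `x`.

NOT CLAIMED: `σ²_w > 0` is ASSUMED here (a sufficient condition — conditional work variance — is
`NCMCGeneralSpaceRestartChainVarianceFloor`); that Wolff's automatic window obeys a deterministic
bracket (see GEN-20 `NCMCGeneralSpaceGammaMethodDataWindow` for clipped data-driven windows);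
unbounded work; finite-`n` coverage; anything numerical.
-/

namespace Summit.Ventures.LatticeQCDFlow.Exactness.GeneralNCMC

open MeasureTheory ProbabilityTheory Set Filter Finset
open scoped ENNReal Topology

/-! ## §1 The studentized `log` event is the printed interval -/

/-- **The studentized event IS the printed interval** when `n ≥ 1`, the variance statistic is positive
and the mean weight is positive: `|√n D · Y · (√v)⁻¹| ≤ z ↔ |D| ≤ z √(v/n) / Y`. -/
theorem abs_studentizedLog_le_iff {n : ℕ} (hn : 0 < n) {D Y v z : ℝ} (hv : 0 < v) (hY : 0 < Y) :
    |Real.sqrt n * D * Y * (Real.sqrt v)⁻¹| ≤ z ↔ |D| ≤ z * Real.sqrt (v / n) / Y := by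
  have hn' : (0 : ℝ) < n := by exact_mod_cast hn
  have hsn : 0 < Real.sqrt n := Real.sqrt_pos.2 hn'
  have hsv : 0 < Real.sqrt v := Real.sqrt_pos.2 hv
  have hq : 0 < Real.sqrt n * Y * (Real.sqrt v)⁻¹ := by positivity
  rw [show Real.sqrt n * D * Y * (Real.sqrt v)⁻¹ = D * (Real.sqrt n * Y * (Real.sqrt v)⁻¹) by ring,
    abs_mul, abs_of_pos hq, ← le_div_iff₀ hq, Real.sqrt_div' v hn'.le]
  constructor <;> intro h <;> refine h.trans_eq ?_ <;> field_simp

/-! ## §2 The Jarzynski lane along the restart chain -/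

variable {Ω E : Type*} [MeasurableSpace Ω] [MeasurableSpace E]

namespace CrooksPair

variable {ν₀ ν₁ : Measure Ω} [IsFiniteMeasure ν₀] [IsFiniteMeasure ν₁] {κF κR : Kernel Ω E}
  [IsMarkovKernel κF] [IsMarkovKernel κR] {s e : E → Ω} {W : E → ℝ}

/-- **THE STUDENTIZED CLT OF THE JARZYNSKI ESTIMATE ALONG CORRELATED STARTS — EXACT ASYMPTOTIC
COVERAGE FROM EVERY INITIAL RECORD LAW.**  Crooks pair with `Z₀ ≠ 0`, `e^{−ΔF} = Z₁/Z₀`; `−B ≤ W`;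
`K` Markov, `ν₀`-invariant, `m ≤ K(z, ·)` for all `z` (`m` finite, `m(Ω) ≠ 0`); the Green–Kubo variance
`σ²_w` of the weights along `R = (κF ∘ₖ K).comap s` positive; windows `W_n → ∞`, `W_n³/n → 0`; `z > 0`.
Then `P_{μ₀}{ |√n (ΔF̂_n − ΔF) · Ȳ_n · (√(Γ̂_n(0) · 2 τ̂_{n,W_n}))⁻¹| ≤ z } → gaussianReal 0 1 (Icc (−z) z)`. -/
theorem tendsto_measure_studentized_jarzynskiEstimate_le_restartChain (K : Kernel Ω Ω)
    [IsMarkovKernel K] (h0 : ν₀ univ ≠ 0) (hK : Kernel.Invariant K ν₀)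
    (h : CrooksPair ν₀ ν₁ κF κR s e W) {ΔF : ℝ}
    (hΔF : Real.exp (-ΔF) = ((ν₀ univ)⁻¹ * ν₁ univ).toReal) {m : Measure Ω} [IsFiniteMeasure m]
    (hm0 : m univ ≠ 0) (hmin : ∀ z, m ≤ K z) {B : ℝ} (hB : ∀ ω, -B ≤ W ω)
    (hσ : 0 < Scoring.autocov ((κF ∘ₖ K).comap s h.measurable_s) (fwdPathLaw ν₀ κF)
          (fun ω => Real.exp (-W ω) - ((ν₀ univ)⁻¹ * ν₁ univ).toReal) 0
        + 2 * ∑' t, Scoring.autocov ((κF ∘ₖ K).comap s h.measurable_s) (fwdPathLaw ν₀ κF)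
          (fun ω => Real.exp (-W ω) - ((ν₀ univ)⁻¹ * ν₁ univ).toReal) (t + 1))
    {Wn : ℕ → ℕ} (hW : Tendsto Wn atTop atTop)
    (hW3 : Tendsto (fun n => (Wn n : ℝ) ^ 3 / n) atTop (𝓝 0)) {z : ℝ} (hz : 0 < z)
    (μ₀ : Measure E) [IsProbabilityMeasure μ₀]
    [IsProbabilityMeasure (Kernel.trajMeasure (X := fun _ : ℕ => E) μ₀
        (fun n : ℕ => ((κF ∘ₖ K).comap s h.measurable_s).comap
          (fun hh : (j : ↥(Finset.Iic n)) → E => hh ⟨n, Finset.mem_Iic.2 le_rfl⟩)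
          (measurable_pi_apply _)))] :
    Tendsto (fun n : ℕ => (Kernel.trajMeasure (X := fun _ : ℕ => E) μ₀
        (fun n : ℕ => ((κF ∘ₖ K).comap s h.measurable_s).comap
          (fun hh : (j : ↥(Finset.Iic n)) → E => hh ⟨n, Finset.mem_Iic.2 le_rfl⟩)
          (measurable_pi_apply _)))
        {ω : ℕ → E | |Real.sqrt n
            * (jarzynskiEstimate (fun ε => Real.exp (-W ε)) (fun i : Fin n => ω i) - ΔF)
            * sampleMean (fun ε => Real.exp (-W ε)) (fun i : Fin n => ω i)
            * (Real.sqrt (Scoring.gammaHat (fun i => Real.exp (-W (ω i))) n 0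
              * (2 * Scoring.tauIntWindow
                (Scoring.rhoHat (fun i => Real.exp (-W (ω i))) n) (Wn n))))⁻¹| ≤ z})
      atTop (𝓝 (gaussianReal 0 1 (Icc (-z) z))) := by
  set P := Kernel.trajMeasure (X := fun _ : ℕ => E) μ₀
    (fun n : ℕ => ((κF ∘ₖ K).comap s h.measurable_s).comap
      (fun hh : (j : ↥(Finset.Iic n)) → E => hh ⟨n, Finset.mem_Iic.2 le_rfl⟩)
      (measurable_pi_apply _)) with hP
  haveI := isProbabilityMeasure_fwdPathLaw ν₀ h0 κF
  haveI := isProbabilityMeasure_normalised_bind_kernel κF hm0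
  set θ : ℝ := ((ν₀ univ)⁻¹ * ν₁ univ).toReal with hθdef
  have hθ : 0 < θ := by rw [← hΔF]; exact Real.exp_pos _
  have hθi : ∫ z, Real.exp (-W z) ∂(fwdPathLaw ν₀ κF) = θ := h.integral_exp_neg_work
  have hwm : Measurable fun ε => Real.exp (-W ε) := Real.measurable_exp.comp h.measurable_W.neg
  have hC : ∀ ω, |Real.exp (-W ω)| ≤ Real.exp B := fun ω => by
    rw [abs_of_pos (Real.exp_pos _)]
    exact Real.exp_le_exp.2 (by linarith [hB ω])
  -- the studentized CLT of the mean weight along the restart chain (GEN-20, `m = 1`)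
  have hσ' : 0 < Scoring.autocov ((κF ∘ₖ K).comap s h.measurable_s) (fwdPathLaw ν₀ κF)
          (fun ω => Real.exp (-W ω) - ∫ z, Real.exp (-W z) ∂(fwdPathLaw ν₀ κF)) 0
        + 2 * ∑' t, Scoring.autocov ((κF ∘ₖ K).comap s h.measurable_s) (fwdPathLaw ν₀ κF)
          (fun ω => Real.exp (-W ω) - ∫ z, Real.exp (-W z) ∂(fwdPathLaw ν₀ κF)) (t + 1) := by
    rw [hθi]; exact hσ
  have hU := tendstoInDistribution_studentized_timeAverage_of_nHit (μ₀ := μ₀)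
    (h.invariant_restartKernel K hK) hm0 (restartKernel_nHit_one_minorised K h hm0 hmin)
    Nat.one_pos hwm hC hσ' hW hW3
  rw [hθi] at hU
  -- the slope factor `−Ȳ_n · dslope log θ Ȳ_n → −1` almost surely, hence in probability
  have hBm : ∀ n, Measurable fun ω : ℕ → E =>
      -(sampleMean (fun ε => Real.exp (-W ε)) (fun i : Fin n => ω i)
        * dslope Real.log θ (sampleMean (fun ε => Real.exp (-W ε)) (fun i : Fin n => ω i))) :=
    fun n => ((measurable_sampleMean_run hwm n).mul
      ((measurable_dslope_log θ).comp (measurable_sampleMean_run hwm n))).neg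
  have hBconv : TendstoInMeasure P (fun n (ω : ℕ → E) =>
      -(sampleMean (fun ε => Real.exp (-W ε)) (fun i : Fin n => ω i)
        * dslope Real.log θ (sampleMean (fun ε => Real.exp (-W ε)) (fun i : Fin n => ω i))))
      atTop (fun _ => -1) := by
    refine tendstoInMeasure_of_tendsto_ae (fun n => (hBm n).aestronglyMeasurable) ?_
    have hae := h.tendsto_sampleMean_restartChain_anyLaw K h0 hK hm0 hmin μ₀
    rw [← hP] at hae
    filter_upwards [hae] with ω hω
    have hmean : Tendsto (fun n : ℕ => sampleMean (fun ε => Real.exp (-W ε)) (fun i : Fin n => ω i))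
        atTop (𝓝 θ) := by
      refine hω.congr fun n => ?_
      unfold sampleMean
      rw [Fin.sum_univ_eq_sum_range (fun i => Real.exp (-W (ω i))) n]
    have hcont : ContinuousAt (dslope Real.log θ) θ :=
      continuousAt_dslope_same.2 (Real.differentiableAt_log hθ.ne')
    have hval : dslope Real.log θ θ = θ⁻¹ := by rw [dslope_same, Real.deriv_log]
    have hd : Tendsto (fun n : ℕ => dslope Real.log θ
        (sampleMean (fun ε => Real.exp (-W ε)) (fun i : Fin n => ω i))) atTop (𝓝 θ⁻¹) := by
      rw [← hval]; exact hcont.tendsto.comp hmean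
    have h1 : (-1 : ℝ) = -(θ * θ⁻¹) := by rw [mul_inv_cancel₀ hθ.ne']
    rw [h1]
    exact (hmean.mul hd).neg
  have key := tendsto_measure_abs_mul_le_of_clt_of_tendstoInMeasure hBm HasLaw.id hU hBconv hz
  have hone : NNReal.mk ((-1 : ℝ) ^ 2) (sq_nonneg _) * (1 : NNReal) = 1 := by
    apply NNReal.eq; simp
  rw [hone] at key
  -- the two events coincide surely: `ΔF̂_n − ΔF = −(Ȳ_n − θ) · dslope log θ Ȳ_n`
  have hΔF' : ΔF = -Real.log θ := by rw [← hΔF, Real.log_exp, neg_neg]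
  refine key.congr fun n => ?_
  congr 1
  ext ω
  simp only [Set.mem_setOf_eq]
  have hds := sub_smul_dslope Real.log θ (sampleMean (fun ε => Real.exp (-W ε)) (fun i : Fin n => ω i))
  rw [smul_eq_mul] at hds
  have hsm : Real.sqrt n * (sampleMean (fun ε => Real.exp (-W ε)) (fun i : Fin n => ω i) - θ)
      = (Real.sqrt n)⁻¹ * ∑ i ∈ Finset.range n, (Real.exp (-W (ω i)) - θ) := by
    unfold sampleMean
    rw [Fin.sum_univ_eq_sum_range (fun i => Real.exp (-W (ω i))) n]
    exact sqrt_mul_mean_sub_eq (fun i => Real.exp (-W (ω i))) θ n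
  have hid : Real.sqrt n
        * (jarzynskiEstimate (fun ε => Real.exp (-W ε)) (fun i : Fin n => ω i) - ΔF)
        * sampleMean (fun ε => Real.exp (-W ε)) (fun i : Fin n => ω i)
        * (Real.sqrt (Scoring.gammaHat (fun i => Real.exp (-W (ω i))) n 0
          * (2 * Scoring.tauIntWindow (Scoring.rhoHat (fun i => Real.exp (-W (ω i))) n) (Wn n))))⁻¹
      = ((Real.sqrt n)⁻¹ * ∑ i ∈ Finset.range n, (Real.exp (-W (ω i)) - θ))
        * (Real.sqrt (Scoring.gammaHat (fun i => Real.exp (-W (ω i))) n 0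
          * (2 * Scoring.tauIntWindow (Scoring.rhoHat (fun i => Real.exp (-W (ω i))) n) (Wn n))))⁻¹
        * -(sampleMean (fun ε => Real.exp (-W ε)) (fun i : Fin n => ω i)
          * dslope Real.log θ (sampleMean (fun ε => Real.exp (-W ε)) (fun i : Fin n => ω i))) := by
    rw [← hsm]
    simp only [jarzynskiEstimate, hΔF']
    linear_combination (Real.sqrt n * sampleMean (fun ε => Real.exp (-W ε)) (fun i : Fin n => ω i)
      * (Real.sqrt (Scoring.gammaHat (fun i => Real.exp (-W (ω i))) n 0
          * (2 * Scoring.tauIntWindow (Scoring.rhoHat (fun i => Real.exp (-W (ω i))) n) (Wn n))))⁻¹)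
      * hds
  rw [hid]

/-- **THE PRINTED Γ-METHOD INTERVAL OF THE JARZYNSKI LANE CONTAINS `ΔF` WITH ASYMPTOTICALLY NOMINAL
PROBABILITY, FROM EVERY INITIAL RECORD LAW.**  Under the hypotheses of
`tendsto_measure_studentized_jarzynskiEstimate_le_restartChain`:
`P_{μ₀}{ |ΔF̂_n − ΔF| ≤ z √(Γ̂_n(0) · 2 τ̂_{n,W_n} / n) / Ȳ_n } → gaussianReal 0 1 (Icc (−z) z)`. -/
theorem tendsto_measure_jarzynskiEstimate_mem_gammaInterval_restartChain (K : Kernel Ω Ω)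
    [IsMarkovKernel K] (h0 : ν₀ univ ≠ 0) (hK : Kernel.Invariant K ν₀)
    (h : CrooksPair ν₀ ν₁ κF κR s e W) {ΔF : ℝ}
    (hΔF : Real.exp (-ΔF) = ((ν₀ univ)⁻¹ * ν₁ univ).toReal) {m : Measure Ω} [IsFiniteMeasure m]
    (hm0 : m univ ≠ 0) (hmin : ∀ z, m ≤ K z) {B : ℝ} (hB : ∀ ω, -B ≤ W ω)
    (hσ : 0 < Scoring.autocov ((κF ∘ₖ K).comap s h.measurable_s) (fwdPathLaw ν₀ κF)
          (fun ω => Real.exp (-W ω) - ((ν₀ univ)⁻¹ * ν₁ univ).toReal) 0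
        + 2 * ∑' t, Scoring.autocov ((κF ∘ₖ K).comap s h.measurable_s) (fwdPathLaw ν₀ κF)
          (fun ω => Real.exp (-W ω) - ((ν₀ univ)⁻¹ * ν₁ univ).toReal) (t + 1))
    {Wn : ℕ → ℕ} (hW : Tendsto Wn atTop atTop)
    (hW3 : Tendsto (fun n => (Wn n : ℝ) ^ 3 / n) atTop (𝓝 0)) {z : ℝ} (hz : 0 < z)
    (μ₀ : Measure E) [IsProbabilityMeasure μ₀]
    [IsProbabilityMeasure (Kernel.trajMeasure (X := fun _ : ℕ => E) μ₀
        (fun n : ℕ => ((κF ∘ₖ K).comap s h.measurable_s).comap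
          (fun hh : (j : ↥(Finset.Iic n)) → E => hh ⟨n, Finset.mem_Iic.2 le_rfl⟩)
          (measurable_pi_apply _)))] :
    Tendsto (fun n : ℕ => (Kernel.trajMeasure (X := fun _ : ℕ => E) μ₀
        (fun n : ℕ => ((κF ∘ₖ K).comap s h.measurable_s).comap
          (fun hh : (j : ↥(Finset.Iic n)) → E => hh ⟨n, Finset.mem_Iic.2 le_rfl⟩)
          (measurable_pi_apply _)))
        {ω : ℕ → E | |jarzynskiEstimate (fun ε => Real.exp (-W ε)) (fun i : Fin n => ω i) - ΔF|
          ≤ z * Real.sqrt (Scoring.gammaHat (fun i => Real.exp (-W (ω i))) n 0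
              * (2 * Scoring.tauIntWindow
                (Scoring.rhoHat (fun i => Real.exp (-W (ω i))) n) (Wn n)) / n)
            / sampleMean (fun ε => Real.exp (-W ε)) (fun i : Fin n => ω i)})
      atTop (𝓝 (gaussianReal 0 1 (Icc (-z) z))) := by
  set P := Kernel.trajMeasure (X := fun _ : ℕ => E) μ₀
    (fun n : ℕ => ((κF ∘ₖ K).comap s h.measurable_s).comap
      (fun hh : (j : ↥(Finset.Iic n)) → E => hh ⟨n, Finset.mem_Iic.2 le_rfl⟩)
      (measurable_pi_apply _)) with hP
  haveI := isProbabilityMeasure_fwdPathLaw ν₀ h0 κF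
  haveI := isProbabilityMeasure_normalised_bind_kernel κF hm0
  set θ : ℝ := ((ν₀ univ)⁻¹ * ν₁ univ).toReal with hθdef
  have hθi : ∫ z, Real.exp (-W z) ∂(fwdPathLaw ν₀ κF) = θ := h.integral_exp_neg_work
  have hwm : Measurable fun ε => Real.exp (-W ε) := Real.measurable_exp.comp h.measurable_W.neg
  have hC : ∀ ω, |Real.exp (-W ω)| ≤ Real.exp B := fun ω => by
    rw [abs_of_pos (Real.exp_pos _)]
    exact Real.exp_le_exp.2 (by linarith [hB ω])
  set σ2 := Scoring.autocov ((κF ∘ₖ K).comap s h.measurable_s) (fwdPathLaw ν₀ κF)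
      (fun ω => Real.exp (-W ω) - θ) 0
    + 2 * ∑' t, Scoring.autocov ((κF ∘ₖ K).comap s h.measurable_s) (fwdPathLaw ν₀ κF)
      (fun ω => Real.exp (-W ω) - θ) (t + 1) with hσ2
  -- the studentized coverage
  have hE := h.tendsto_measure_studentized_jarzynskiEstimate_le_restartChain K h0 hK hΔF hm0 hmin hB
    hσ hW hW3 hz μ₀
  rw [← hP] at hE
  -- the variance statistic converges in probability to `σ²_w > 0`
  have hmin' := restartKernel_nHit_one_minorised K h hm0 hmin
  haveI : Nonempty E := nonempty_of_isProbabilityMeasure μ₀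
  have hε1 : m univ ≤ 1 := by
    haveI := isMarkovKernel_nHit ((κF ∘ₖ K).comap s h.measurable_s) 1
    exact eps_le_one_of_minorised hmin'
  have hcons := chain_gammaWindow_tendstoInMeasure_of_nHit μ₀ (fun z B hB => minorised_setwise hmin' z hB)
    (pos_iff_ne_zero.2 hm0) hε1 Nat.one_pos (h.invariant_restartKernel K hK) hwm
    hC hW hW3
  rw [← hP, hθi] at hcons
  set V : ℕ → (ℕ → E) → ℝ := fun n ω => Scoring.gammaHat (fun i => Real.exp (-W (ω i))) n 0
    * (2 * Scoring.tauIntWindow (Scoring.rhoHat (fun i => Real.exp (-W (ω i))) n) (Wn n)) with hV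
  set Bn : ℕ → Set (ℕ → E) := fun n => {ω | V n ω ≤ 0} ∪ {ω | n = 0} with hBdef
  have hBt : Tendsto (fun n => P (Bn n)) atTop (𝓝 0) := by
    have h1 : Tendsto (fun n => P {ω | V n ω ≤ 0}) atTop (𝓝 0) := by
      have hc := hcons (ENNReal.ofReal σ2) (by simpa using hσ)
      refine tendsto_of_tendsto_of_tendsto_of_le_of_le tendsto_const_nhds hc (fun n => bot_le)
        fun n => measure_mono fun ω hω => ?_
      simp only [Set.mem_setOf_eq] at hω ⊢
      rw [edist_dist, Real.dist_eq]
      refine ENNReal.ofReal_le_ofReal ?_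
      rw [show V n ω = Scoring.gammaHat (fun i => Real.exp (-W (ω i))) n 0
          * (2 * Scoring.tauIntWindow (Scoring.rhoHat (fun i => Real.exp (-W (ω i))) n) (Wn n))
          from rfl] at hω
      rw [abs_sub_comm]
      linarith [le_abs_self (σ2 - Scoring.gammaHat (fun i => Real.exp (-W (ω i))) n 0
        * (2 * Scoring.tauIntWindow (Scoring.rhoHat (fun i => Real.exp (-W (ω i))) n) (Wn n)))]
    have h2 : Tendsto (fun n : ℕ => P {ω : ℕ → E | n = 0}) atTop (𝓝 0) := by
      refine tendsto_const_nhds.congr' ?_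
      filter_upwards [Filter.eventually_gt_atTop 0] with n hn
      rw [show {ω : ℕ → E | n = 0} = ∅ from Set.eq_empty_of_forall_notMem fun ω hω => hn.ne' hω,
        measure_empty]
    have h12 := h1.add h2
    rw [add_zero] at h12
    exact tendsto_of_tendsto_of_tendsto_of_le_of_le tendsto_const_nhds h12 (fun n => bot_le)
      fun n => measure_union_le _ _
  -- positivity of the mean weight for `n ≥ 1`
  have hYpos : ∀ {n : ℕ}, 0 < n → ∀ ω : ℕ → E,
      0 < sampleMean (fun ε => Real.exp (-W ε)) (fun i : Fin n => ω i) := by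
    intro n hn ω
    unfold sampleMean
    have hn' : (0 : ℝ) < n := by exact_mod_cast hn
    haveI : Nonempty (Fin n) := ⟨⟨0, hn⟩⟩
    exact div_pos (Finset.sum_pos (fun i _ => Real.exp_pos _) Finset.univ_nonempty) hn'
  refine tendsto_measure_of_eq_off_vanishing hBt (fun n => ?_) hE
  ext ω
  simp only [hBdef, Set.mem_inter_iff, Set.mem_compl_iff, Set.mem_union, Set.mem_setOf_eq, not_or,
    not_le]
  constructor
  · rintro ⟨hle, hVpos, hn⟩
    refine ⟨?_, hVpos, hn⟩
    have hn0 : 0 < n := Nat.pos_of_ne_zero hn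
    exact (abs_studentizedLog_le_iff hn0 (z := z)
      (D := jarzynskiEstimate (fun ε => Real.exp (-W ε)) (fun i : Fin n => ω i) - ΔF)
      hVpos (hYpos hn0 ω)).1 hle
  · rintro ⟨hle, hVpos, hn⟩
    refine ⟨?_, hVpos, hn⟩
    have hn0 : 0 < n := Nat.pos_of_ne_zero hn
    exact (abs_studentizedLog_le_iff hn0 (z := z)
      (D := jarzynskiEstimate (fun ε => Real.exp (-W ε)) (fun i : Fin n => ω i) - ΔF)
      hVpos (hYpos hn0 ω)).2 hle

/-- **THE PRINTED INTERVAL FROM EVERY INITIAL CONFIGURATION** (the engine's form: first record launched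
from ANY configuration `x`, then `K` between launches):
`P{ |ΔF̂_n − ΔF| ≤ z √(Γ̂_n(0) · 2 τ̂_{n,W_n} / n) / Ȳ_n } → gaussianReal 0 1 (Icc (−z) z)`. -/
theorem tendsto_measure_jarzynskiEstimate_mem_gammaInterval_restartChain_everyStart
    (K : Kernel Ω Ω) [IsMarkovKernel K] (h0 : ν₀ univ ≠ 0) (hK : Kernel.Invariant K ν₀)
    (h : CrooksPair ν₀ ν₁ κF κR s e W) {ΔF : ℝ}
    (hΔF : Real.exp (-ΔF) = ((ν₀ univ)⁻¹ * ν₁ univ).toReal) {m : Measure Ω} [IsFiniteMeasure m]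
    (hm0 : m univ ≠ 0) (hmin : ∀ z, m ≤ K z) {B : ℝ} (hB : ∀ ω, -B ≤ W ω)
    (hσ : 0 < Scoring.autocov ((κF ∘ₖ K).comap s h.measurable_s) (fwdPathLaw ν₀ κF)
          (fun ω => Real.exp (-W ω) - ((ν₀ univ)⁻¹ * ν₁ univ).toReal) 0
        + 2 * ∑' t, Scoring.autocov ((κF ∘ₖ K).comap s h.measurable_s) (fwdPathLaw ν₀ κF)
          (fun ω => Real.exp (-W ω) - ((ν₀ univ)⁻¹ * ν₁ univ).toReal) (t + 1))
    {Wn : ℕ → ℕ} (hW : Tendsto Wn atTop atTop)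
    (hW3 : Tendsto (fun n => (Wn n : ℝ) ^ 3 / n) atTop (𝓝 0)) {z : ℝ} (hz : 0 < z) (x : Ω)
    [IsProbabilityMeasure (Kernel.trajMeasure (X := fun _ : ℕ => E) (κF x)
        (fun n : ℕ => ((κF ∘ₖ K).comap s h.measurable_s).comap
          (fun hh : (j : ↥(Finset.Iic n)) → E => hh ⟨n, Finset.mem_Iic.2 le_rfl⟩)
          (measurable_pi_apply _)))] :
    Tendsto (fun n : ℕ => (Kernel.trajMeasure (X := fun _ : ℕ => E) (κF x)
        (fun n : ℕ => ((κF ∘ₖ K).comap s h.measurable_s).comap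
          (fun hh : (j : ↥(Finset.Iic n)) → E => hh ⟨n, Finset.mem_Iic.2 le_rfl⟩)
          (measurable_pi_apply _)))
        {ω : ℕ → E | |jarzynskiEstimate (fun ε => Real.exp (-W ε)) (fun i : Fin n => ω i) - ΔF|
          ≤ z * Real.sqrt (Scoring.gammaHat (fun i => Real.exp (-W (ω i))) n 0
              * (2 * Scoring.tauIntWindow
                (Scoring.rhoHat (fun i => Real.exp (-W (ω i))) n) (Wn n)) / n)
            / sampleMean (fun ε => Real.exp (-W ε)) (fun i : Fin n => ω i)})
      atTop (𝓝 (gaussianReal 0 1 (Icc (-z) z))) :=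
  h.tendsto_measure_jarzynskiEstimate_mem_gammaInterval_restartChain K h0 hK hΔF hm0 hmin hB hσ hW
    hW3 hz (κF x)

end CrooksPair

end Summit.Ventures.LatticeQCDFlow.Exactness.GeneralNCMC

/-! ## §3 (GEN-22 append) Every bounded record statistic (acceptance, bounded work, end-point
observables): its printed Γ-method interval `ḡ_n ± z √(Γ̂_n(0) · 2 τ̂_{n,W_n}/n)` covers `E_F g` with
asymptotically nominal probability along the restart chain from EVERY initial record law (GEN-20's
`tendsto_measure_mean_mem_gammaInterval_of_nHit` on `R`; `σ²_g > 0` assumed — discharged for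
stochastic protocols by `NCMCGeneralSpaceRestartChainVarianceFloor`). -/

namespace Summit.Ventures.LatticeQCDFlow.Exactness.GeneralNCMC

open MeasureTheory ProbabilityTheory Set Filter Finset
open scoped ENNReal Topology

namespace CrooksPair

variable {Ω E : Type*} [MeasurableSpace Ω] [MeasurableSpace E]
variable {ν₀ ν₁ : Measure Ω} [IsFiniteMeasure ν₀] [IsFiniteMeasure ν₁] {κF κR : Kernel Ω E}
  [IsMarkovKernel κF] [IsMarkovKernel κR] {s e : E → Ω} {W : E → ℝ}

omit [IsFiniteMeasure ν₁] [IsMarkovKernel κR] in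
/-- **THE PRINTED Γ-METHOD INTERVAL OF ANY BOUNDED RECORD STATISTIC IS ASYMPTOTICALLY EXACT ALONG THE
RESTART CHAIN, FROM EVERY INITIAL RECORD LAW.**  Crooks pair with `Z₀ ≠ 0`; `K` Markov, `ν₀`-invariant,
`m ≤ K(z, ·)` for all `z` (`m(Ω) ≠ 0`); `g` measurable, `|g| ≤ C`, with positive Green–Kubo variance
along `R = (κF ∘ₖ K).comap s`; windows `W_n → ∞`, `W_n³/n → 0`; `z > 0`.  Then
`P_{μ₀}{ |(1/n) Σ_{i<n} g(ω_i) − ∫ g dP_F| ≤ z √(Γ̂_n(0) · 2 τ̂_{n,W_n} / n) } → gaussianReal 0 1 (Icc (−z) z)`. -/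
theorem tendsto_measure_mean_mem_gammaInterval_restartChain (K : Kernel Ω Ω) [IsMarkovKernel K]
    (h0 : ν₀ univ ≠ 0) (hK : Kernel.Invariant K ν₀) (h : CrooksPair ν₀ ν₁ κF κR s e W)
    {m : Measure Ω} [IsFiniteMeasure m] (hm0 : m univ ≠ 0) (hmin : ∀ z, m ≤ K z)
    {g : E → ℝ} (hg : Measurable g) {C : ℝ} (hC : ∀ ω, |g ω| ≤ C)
    (hσ : 0 < Scoring.autocov ((κF ∘ₖ K).comap s h.measurable_s) (fwdPathLaw ν₀ κF)
          (fun ω => g ω - ∫ z, g z ∂(fwdPathLaw ν₀ κF)) 0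
        + 2 * ∑' t, Scoring.autocov ((κF ∘ₖ K).comap s h.measurable_s) (fwdPathLaw ν₀ κF)
          (fun ω => g ω - ∫ z, g z ∂(fwdPathLaw ν₀ κF)) (t + 1))
    {Wn : ℕ → ℕ} (hW : Tendsto Wn atTop atTop)
    (hW3 : Tendsto (fun n => (Wn n : ℝ) ^ 3 / n) atTop (𝓝 0)) {z : ℝ} (hz : 0 < z)
    (μ₀ : Measure E) [IsProbabilityMeasure μ₀]
    [IsProbabilityMeasure (Kernel.trajMeasure (X := fun _ : ℕ => E) μ₀
        (fun n : ℕ => ((κF ∘ₖ K).comap s h.measurable_s).comap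
          (fun hh : (j : ↥(Finset.Iic n)) → E => hh ⟨n, Finset.mem_Iic.2 le_rfl⟩)
          (measurable_pi_apply _)))] :
    Tendsto (fun n : ℕ => (Kernel.trajMeasure (X := fun _ : ℕ => E) μ₀
        (fun n : ℕ => ((κF ∘ₖ K).comap s h.measurable_s).comap
          (fun hh : (j : ↥(Finset.Iic n)) → E => hh ⟨n, Finset.mem_Iic.2 le_rfl⟩)
          (measurable_pi_apply _)))
        {ω : ℕ → E | |(∑ i ∈ range n, g (ω i)) / n - ∫ z, g z ∂(fwdPathLaw ν₀ κF)|
          ≤ z * Real.sqrt (Scoring.gammaHat (fun i => g (ω i)) n 0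
            * (2 * Scoring.tauIntWindow (Scoring.rhoHat (fun i => g (ω i)) n) (Wn n)) / n)})
      atTop (𝓝 (gaussianReal 0 1 (Icc (-z) z))) := by
  haveI := isProbabilityMeasure_fwdPathLaw ν₀ h0 κF
  haveI := isProbabilityMeasure_normalised_bind_kernel κF hm0
  exact tendsto_measure_mean_mem_gammaInterval_of_nHit μ₀ (h.invariant_restartKernel K hK) hm0
    (restartKernel_nHit_one_minorised K h hm0 hmin) Nat.one_pos hg hC hσ hW hW3 hz

end CrooksPair

end Summit.Ventures.LatticeQCDFlow.Exactness.GeneralNCMC
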